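import Literature.Geometry.Symplectic.SurfaceTubeMoserFlow
import Literature.Geometry.Symplectic.SurfaceTubeMomentMap
import Literature.Geometry.Symplectic.CircleQuotientForms
import Literature.Geometry.Manifold.OpenSubmanifoldMFDeriv
import Mathlib.Geometry.Manifold.WhitneyEmbedding
import HarnessLib

/-!
# The symplectic tube of a closed symplectic surface with its Hamiltonian circle action

Topic `Literature/Geometry/Symplectic`; layer C7 (packaging) of the construction of the symplectic
tubular neighbourhood with its `U(1)`-structure of a closed symplectic surface `b : S → N` in a
compact symplectic `4`-manifold — **McLean, GAFA 2012, Lemma 5.14 for `k = 1`**: a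
neighbourhood of a positively intersecting (here: single, smooth) symplectic divisor is
symplectomorphic to a neighbourhood of the zero section of a symplectic disc bundle with a
`U(1)`-structure whose rotation action is Hamiltonian, generated by `-ρ²/2`.

Transporting the model of `SurfaceTubeCircleAction.lean` (rotation `rot` of the round tube,
fundamental field `X_m`), `SurfaceTubeMomentMap.lean` (`s_M (X_m, ·) = -½ dρ²`) by the Moser
isotopy `Ψ₁` of `SurfaceTubeMoserFlow.lean` (`Ψ₁^* s = s_M` near the surface, `Ψ₁ = id` on it):

* `Setup.Φ = Ψ₁`, the punctured tube `W = Φ (T ε₅ ∖ b(S))` (an open set of `N`), the tube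
  `V = Φ (T ε₅)`, the conjugated action `a • y = Φ (rot a (Φ⁻¹ y))` on `W`, the transported
  squared radius `r2 = (χ₅ ρ²) ∘ Φ⁻¹` (globally smooth);
* `Setup.tubeData` — all the properties consumed by the tree's
  `Literature.Geometry.Symplectic.mclean_convex_of_tubeData` (smooth free action with
  non-vanishing fundamental field, invariance of `r2`, the moment-map identity
  `s (X, ·) = d(-r2/2)` on `W`, the topology of the tube: closed sub-tubes, the shell,
  preconnectedness of the punctured tube);
* `SurfaceTube.exists_tubeData` — the same from the bare hypotheses of the fact
  `mclean_divisorComplement_convex_four` (Whitney embedding of `N`, `Setup` assembled; the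
  degenerate case of an empty surface apart).

Everything here is proved; no named facts (D-0026).

## References

* M. McLean, *The growth rate of symplectic homology and affine varieties*, GAFA 22 (2012),
  Lemma 5.14 and proof of Lemma 5.17 (arXiv:1011.2542, pp. 33–37). [Mclean2012]
* D. McDuff, D. Salamon, *Introduction to Symplectic Topology*, 3rd ed. (2017), Thm. 3.4.10,
  §3.2. [McDuffSalamon2017]
-/

noncomputable section

open scoped Manifold ContDiff Topology
open Set Function Module Filter Metric Bundle
open Literature.Topology.FourManifolds
open Literature.Geometry.Kaehler
open Literature.Geometry.Manifold

namespace Literature.Geometry.Symplectic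

namespace SurfaceTube

/-- Local notation for the model space. -/
local notation "E4" => EuclideanSpace ℝ (Fin 4)

variable {N : Type*} [TopologicalSpace N] [ChartedSpace (EuclideanSpace ℝ (Fin 4)) N]
  [IsManifold (𝓡 4) ∞ N] {S : Type*} [TopologicalSpace S] [ChartedSpace (EuclideanSpace ℝ (Fin 2)) S]
  [IsManifold (𝓡 2) ∞ S] {V : Type*} [NormedAddCommGroup V] [InnerProductSpace ℝ V]
  [FiniteDimensional ℝ V] (D : Setup N S V)

namespace Setup

variable [CompactSpace S] [Nonempty S] [T2Space S] [T2Space N] [CompactSpace N]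

/-! ### The final level and the Moser diffeomorphism -/

/-- A tube level `ε₅` with `Tbar ε₅ ⊆ O₄`. [folklore] -/
theorem exists_level₅ : ∃ ε : ℝ, 0 < ε ∧ ε < D.εc ∧ D.Tbar ε ⊆ D.O₄ :=
  D.exists_Tbar_subset D.isOpen_O₄ D.range_b_subset_O₄

/-- **The level `ε₅`** of the final tube. [folklore] -/
def ε₅ : ℝ := D.exists_level₅.choose

/-- `0 < ε₅`. [folklore] -/
theorem ε₅_pos : 0 < D.ε₅ := D.exists_level₅.choose_spec.1

/-- `ε₅ < εc`. [folklore] -/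
theorem ε₅_lt : D.ε₅ < D.εc := D.exists_level₅.choose_spec.2.1

/-- `Tbar ε₅ ⊆ O₄`. [folklore] -/
theorem Tbar₅_subset_O₄ : D.Tbar D.ε₅ ⊆ D.O₄ := D.exists_level₅.choose_spec.2.2

/-- `T ε₅ ⊆ O₄`. [folklore] -/
theorem T₅_subset_O₄ : D.T D.ε₅ ⊆ D.O₄ := (D.T_subset_Tbar _).trans D.Tbar₅_subset_O₄

/-- **The Moser diffeomorphism** `Φ = Ψ₁`. [cite: McDuffSalamon2017, §3.2] -/
def Mo : N ≃ₘ^∞⟮𝓡 4, 𝓡 4⟯ N := D.Ψ.toDiffeomorph 1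

/-- `Φ = Ψ₁` pointwise. [folklore] -/
theorem Mo_apply (x : N) : D.Mo x = D.Ψ.toFun 1 x := rfl

/-- `Φ` as a function is `Ψ₁`. [folklore] -/
theorem coe_Mo : (D.Mo : N → N) = D.Ψ.toFun 1 := rfl

/-- `Φ` fixes the surface. [folklore] -/
theorem Mo_b (y : S) : D.Mo (D.b y) = D.b y := D.Ψ_b 1 y

/-- `Φ⁻¹` fixes the surface. [folklore] -/
theorem Mo_symm_b (y : S) : D.Mo.symm (D.b y) = D.b y := by
  conv_lhs => rw [← D.Mo_b y]
  exact D.Mo.symm_apply_apply _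

/-- `Φ x` is on the surface iff `x` is. [folklore] -/
theorem Mo_mem_range_iff (x : N) : D.Mo x ∈ range D.b ↔ x ∈ range D.b := by
  constructor
  · rintro ⟨y, hy⟩
    refine ⟨y, ?_⟩
    rw [← D.Mo_b y] at hy
    exact D.Mo.injective hy
  · rintro ⟨y, rfl⟩
    exact ⟨y, (D.Mo_b y).symm⟩

/-- `Φ⁻¹ y` is on the surface iff `y` is. [folklore] -/
theorem Mo_symm_mem_range_iff (y : N) : D.Mo.symm y ∈ range D.b ↔ y ∈ range D.b := by
  conv_rhs => rw [← D.Mo.apply_symm_apply y]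
  exact (D.Mo_mem_range_iff _).symm

/-- `dΦ⁻¹ ∘ dΦ = id`. [folklore] -/
theorem mfderiv_symm_mfderiv (x : N) (v : E4) :
    mfderiv (𝓡 4) (𝓡 4) D.Mo.symm (D.Mo x) (mfderiv (𝓡 4) (𝓡 4) D.Mo x v) = v := by
  have hf : MDifferentiableAt (𝓡 4) (𝓡 4) D.Mo x := D.Mo.contMDiffAt.mdifferentiableAt (by simp)
  have hg : MDifferentiableAt (𝓡 4) (𝓡 4) D.Mo.symm (D.Mo x) :=
    D.Mo.symm.contMDiffAt.mdifferentiableAt (by simp)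
  have h := mfderiv_comp x hg hf
  have hid : (D.Mo.symm ∘ D.Mo : N → N) = id := funext fun z ↦ D.Mo.symm_apply_apply z
  rw [hid, mfderiv_id] at h
  have key : v = mfderiv (𝓡 4) (𝓡 4) D.Mo.symm (D.Mo x) (mfderiv (𝓡 4) (𝓡 4) D.Mo x v) :=
    ContinuousLinearMap.ext_iff.1 h v
  exact key.symm

/-- `dΦ ∘ dΦ⁻¹ = id`. [folklore] -/
theorem mfderiv_mfderiv_symm (y : N) (w : E4) :
    mfderiv (𝓡 4) (𝓡 4) D.Mo (D.Mo.symm y) (mfderiv (𝓡 4) (𝓡 4) D.Mo.symm y w) = w := by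
  have hf : MDifferentiableAt (𝓡 4) (𝓡 4) D.Mo.symm y := D.Mo.symm.contMDiffAt.mdifferentiableAt (by simp)
  have hg : MDifferentiableAt (𝓡 4) (𝓡 4) D.Mo (D.Mo.symm y) :=
    D.Mo.contMDiffAt.mdifferentiableAt (by simp)
  have h := mfderiv_comp y hg hf
  have hid : (D.Mo ∘ D.Mo.symm : N → N) = id := funext fun z ↦ D.Mo.apply_symm_apply z
  rw [hid, mfderiv_id] at h
  have key : w = mfderiv (𝓡 4) (𝓡 4) D.Mo (D.Mo.symm y) (mfderiv (𝓡 4) (𝓡 4) D.Mo.symm y w) :=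
    ContinuousLinearMap.ext_iff.1 h w
  exact key.symm

/-- `dΦ ∘ dΦ⁻¹ = id`, at a point `Φ x`. [folklore] -/
theorem mfderiv_mfderiv_symm' (x : N) (w : E4) :
    mfderiv (𝓡 4) (𝓡 4) D.Mo x (mfderiv (𝓡 4) (𝓡 4) D.Mo.symm (D.Mo x) w) = w := by
  have h := D.mfderiv_mfderiv_symm (D.Mo x) w
  rwa [D.Mo.symm_apply_apply] at h

/-! ### The tube, the punctured tube and the conjugated action -/

/-- **The tube** `V = Φ (T ε₅)`. [cite: Mclean2012, Lemma 5.14] -/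
def Vset : Set N := D.Mo '' D.T D.ε₅

/-- **The punctured tube** `W = Φ (T ε₅ ∖ b(S))`. [cite: Mclean2012, Lemma 5.14] -/
def Wset : Set N := D.Mo '' (D.T D.ε₅ \ range D.b)

/-- `V` is open. [folklore] -/
theorem isOpen_Vset : IsOpen D.Vset := by
  have h := D.Mo.toHomeomorph.isOpenMap _ (D.isOpen_T D.ε₅)
  rwa [Diffeomorph.coe_toHomeomorph] at h

omit [Nonempty S] [T2Space S] [CompactSpace N] in
/-- The surface is closed. [folklore] -/
theorem isClosed_range_b : IsClosed (range D.b) :=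
  (isCompact_range D.hb.continuous).isClosed

/-- `W` is open. [folklore] -/
theorem isOpen_Wset : IsOpen D.Wset := by
  have h := D.Mo.toHomeomorph.isOpenMap _ ((D.isOpen_T D.ε₅).sdiff D.isClosed_range_b)
  rwa [Diffeomorph.coe_toHomeomorph] at h

/-- The punctured tube as an open set of `N`. [folklore] -/
def Wop : TopologicalSpace.Opens N := ⟨D.Wset, D.isOpen_Wset⟩

/-- Membership in `Wop`. [folklore] -/
theorem mem_Wop_iff {y : N} : y ∈ D.Wop ↔ y ∈ D.Wset := Iff.rfl

/-- `W ⊆ V`. [folklore] -/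
theorem Wset_subset_Vset : D.Wset ⊆ D.Vset := by
  rintro _ ⟨x, hx, rfl⟩; exact ⟨x, hx.1, rfl⟩

/-- `W` misses the surface. [folklore] -/
theorem Wset_subset_compl : D.Wset ⊆ (range D.b)ᶜ := by
  rintro _ ⟨x, hx, rfl⟩ h
  exact hx.2 ((D.Mo_mem_range_iff x).1 h)

/-- Points of `V` come from `T ε₅`. [folklore] -/
theorem symm_mem_of_mem_Vset {y : N} (hy : y ∈ D.Vset) : D.Mo.symm y ∈ D.T D.ε₅ := by
  obtain ⟨x, hx, rfl⟩ := hy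
  rwa [D.Mo.symm_apply_apply]

/-- Points of `W` come from `T ε₅ ∖ b(S)`. [folklore] -/
theorem symm_mem_of_mem_Wset {y : N} (hy : y ∈ D.Wset) : D.Mo.symm y ∈ D.T D.ε₅ \ range D.b := by
  obtain ⟨x, hx, rfl⟩ := hy
  rwa [D.Mo.symm_apply_apply]

/-- **The conjugated action** `a • y = Φ (rot a (Φ⁻¹ y))` as a map of `N`. [cite: Mclean2012, Lemma 5.14] -/
def actFun (a : Circle) (y : N) : N := D.Mo (D.rot a (D.Mo.symm y))

/-- The conjugated action on points `Φ x`. [folklore] -/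
theorem actFun_Mo (a : Circle) (x : N) : D.actFun a (D.Mo x) = D.Mo (D.rot a x) := by
  rw [actFun, D.Mo.symm_apply_apply]

/-- The conjugated action preserves `W`. [folklore] -/
theorem actFun_mem (a : Circle) {y : N} (hy : y ∈ D.Wset) : D.actFun a y ∈ D.Wset := by
  obtain ⟨x, hx, rfl⟩ := hy
  rw [D.actFun_Mo]
  exact ⟨D.rot a x, D.rot_mem_T_diff a hx, rfl⟩

/-- `1` acts trivially. [folklore] -/
theorem actFun_one {y : N} (hy : y ∈ D.Wset) : D.actFun 1 y = y := by
  obtain ⟨x, hx, rfl⟩ := hy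
  rw [D.actFun_Mo, D.rot_one (D.T_subset_N₃ _ hx.1)]

/-- The action law. [folklore] -/
theorem actFun_mul (a c : Circle) {y : N} (hy : y ∈ D.Wset) :
    D.actFun a (D.actFun c y) = D.actFun (a * c) y := by
  obtain ⟨x, hx, rfl⟩ := hy
  rw [D.actFun_Mo, D.actFun_Mo, D.actFun_Mo, D.rot_mul a c (D.T_subset_N₃ _ hx.1)]

/-- **The conjugated action is free on `W`.** [cite: Mclean2012, Lemma 5.14] -/
theorem eq_one_of_actFun_eq {a : Circle} {y : N} (hy : y ∈ D.Wset) (h : D.actFun a y = y) : a = 1 := by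
  obtain ⟨x, hx, rfl⟩ := hy
  rw [D.actFun_Mo] at h
  exact D.eq_one_of_rot_eq (D.T_subset_N₃ _ hx.1) hx.2 (D.Mo.injective h)

/-- **The conjugated action is smooth** at the points over `N₃`. [folklore] -/
theorem contMDiffAt_actFun {p : Circle × N} (hp : D.Mo.symm p.2 ∈ D.N₃) :
    ContMDiffAt ((𝓡 1).prod (𝓡 4)) (𝓡 4) ∞ (fun p : Circle × N ↦ D.actFun p.1 p.2) p := by
  have h1 : ContMDiff ((𝓡 1).prod (𝓡 4)) ((𝓡 1).prod (𝓡 4)) ∞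
      (fun p : Circle × N ↦ ((p.1, D.Mo.symm p.2) : Circle × N)) :=
    contMDiff_fst.prodMk (D.Mo.symm.contMDiff.comp contMDiff_snd)
  have h2 : ContMDiffAt ((𝓡 1).prod (𝓡 4)) (𝓡 4) ∞ (fun p : Circle × N ↦ D.rot p.1 p.2)
      (p.1, D.Mo.symm p.2) :=
    D.contMDiffOn_rot.contMDiffAt ((isOpen_univ.prod D.isOpen_N₃).mem_nhds ⟨mem_univ _, hp⟩)
  have h12 : ContMDiffAt ((𝓡 1).prod (𝓡 4)) (𝓡 4) ∞
      (fun p : Circle × N ↦ D.rot p.1 (D.Mo.symm p.2)) p :=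
    ContMDiffAt.comp (I' := (𝓡 1).prod (𝓡 4)) (g := fun p : Circle × N ↦ D.rot p.1 p.2)
      (f := fun p : Circle × N ↦ ((p.1, D.Mo.symm p.2) : Circle × N)) p h2 (h1 p)
  exact ContMDiffAt.comp (I' := 𝓡 4) (g := D.Mo) (f := fun p : Circle × N ↦ D.rot p.1 (D.Mo.symm p.2)) p
    D.Mo.contMDiffAt h12

/-- **The conjugated action on the open submanifold `W`.** [cite: Mclean2012, Lemma 5.14] -/
@[reducible] def act : MulAction Circle D.Wop where
  smul a y := ⟨D.actFun a y, D.actFun_mem a y.2⟩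
  one_smul y := Subtype.ext (D.actFun_one y.2)
  mul_smul a c y := Subtype.ext (D.actFun_mul a c y.2).symm

/-- Unfolding of the action. [folklore] -/
theorem act_smul_val (a : Circle) (y : D.Wop) :
    (letI := D.act; ((a • y : D.Wop) : N)) = D.actFun a y := rfl

/-! ### The transported squared radius -/

/-- The outer level `ε₆ = (ε₅ + εc)/2`. [folklore] -/
def ε₆ : ℝ := (D.ε₅ + D.εc) / 2

/-- `ε₅ < ε₆`. [folklore] -/
theorem ε₅_lt_ε₆ : D.ε₅ < D.ε₆ := by rw [ε₆]; linarith [D.ε₅_lt]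

/-- `ε₆ < εc`. [folklore] -/
theorem ε₆_lt : D.ε₆ < D.εc := by rw [ε₆]; linarith [D.ε₅_lt]

/-- Existence of the radial cut-off. [folklore] -/
theorem exists_radialCut : ∃ χ : N → ℝ, ContMDiff (𝓡 4) 𝓘(ℝ, ℝ) ∞ χ ∧
    (∀ x ∈ D.Tbar D.ε₅, χ x = 1) ∧ (∀ x ∉ D.T D.ε₆, χ x = 0) := by
  obtain ⟨f, h0, h1, -⟩ := exists_contMDiffMap_zero_one_of_isClosed (I := 𝓡 4) (n := (⊤ : ℕ∞))
    (D.isOpen_T D.ε₆).isClosed_compl (D.isClosed_Tbar D.ε₅_lt)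
    (disjoint_compl_left_iff_subset.2 (D.Tbar_subset_T D.ε₅_lt_ε₆))
  exact ⟨f, f.contMDiff, fun x hx ↦ h1 hx, fun x hx ↦ h0 hx⟩

/-- **The radial cut-off** `χ₅`: `1` on `Tbar ε₅`, `0` off `T ε₆`. [folklore] -/
def χ₅ : N → ℝ := D.exists_radialCut.choose

/-- `χ₅` is smooth. [folklore] -/
theorem contMDiff_χ₅ : ContMDiff (𝓡 4) 𝓘(ℝ, ℝ) ∞ D.χ₅ := D.exists_radialCut.choose_spec.1

/-- `χ₅ = 1` on `Tbar ε₅`. [folklore] -/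
theorem χ₅_eq_one {x : N} (hx : x ∈ D.Tbar D.ε₅) : D.χ₅ x = 1 := D.exists_radialCut.choose_spec.2.1 x hx

/-- `χ₅ = 0` off `T ε₆`. [folklore] -/
theorem χ₅_eq_zero {x : N} (hx : x ∉ D.T D.ε₆) : D.χ₅ x = 0 := D.exists_radialCut.choose_spec.2.2 x hx

/-- **The globalised squared radius** `g = χ₅ ρ²` (`= ρ²` on `Tbar ε₅`). [folklore] -/
def g (x : N) : ℝ := D.χ₅ x * D.ρ2 x

/-- `g = ρ²` near every point of `T ε₅`. [folklore] -/
theorem g_eventuallyEq {x : N} (hx : x ∈ D.T D.ε₅) : D.g =ᶠ[𝓝 x] D.ρ2 := by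
  filter_upwards [(D.isOpen_T D.ε₅).mem_nhds hx] with z hz
  rw [g, D.χ₅_eq_one (D.T_subset_Tbar _ hz), one_mul]

/-- `g = ρ²` on `T ε₅`. [folklore] -/
theorem g_eq {x : N} (hx : x ∈ D.T D.ε₅) : D.g x = D.ρ2 x := (D.g_eventuallyEq hx).self_of_nhds

/-- **`g` is smooth on all of `N`.** [folklore] -/
theorem contMDiff_g : ContMDiff (𝓡 4) 𝓘(ℝ, ℝ) ∞ D.g := by
  intro x
  by_cases hx : x ∈ D.Tbar D.ε₆
  · have hx1 : x ∈ D.N₁ := D.N₃_subset_N₁ hx.1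
    exact (D.contMDiff_χ₅ x).mul ((D.contMDiffOn_ρ2 x hx1).contMDiffAt (D.isOpen_N₁.mem_nhds hx1))
  · have hev : D.g =ᶠ[𝓝 x] fun _ ↦ 0 := by
      filter_upwards [(D.isClosed_Tbar D.ε₆_lt).isOpen_compl.mem_nhds hx] with z hz
      rw [g, D.χ₅_eq_zero (fun h ↦ hz (D.T_subset_Tbar _ h)), zero_mul]
    exact contMDiffAt_const.congr_of_eventuallyEq hev

/-- **The transported squared radius** `r2 = g ∘ Φ⁻¹`. [cite: Mclean2012, Lemma 5.14] -/
def r2 (y : N) : ℝ := D.g (D.Mo.symm y)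

/-- `r2` is smooth on all of `N`. [folklore] -/
theorem contMDiff_r2 : ContMDiff (𝓡 4) 𝓘(ℝ, ℝ) ∞ D.r2 := D.contMDiff_g.comp D.Mo.symm.contMDiff

/-- `r2 (Φ x) = ρ² x` on `T ε₅`. [folklore] -/
theorem r2_Mo {x : N} (hx : x ∈ D.T D.ε₅) : D.r2 (D.Mo x) = D.ρ2 x := by
  rw [r2, D.Mo.symm_apply_apply, D.g_eq hx]

/-- `r2` is invariant under the conjugated action. [folklore] -/
theorem r2_actFun (a : Circle) {y : N} (hy : y ∈ D.Wset) : D.r2 (D.actFun a y) = D.r2 y := by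
  obtain ⟨x, hx, rfl⟩ := hy
  rw [D.actFun_Mo, D.r2_Mo (D.rot_mem_T a hx.1), D.r2_Mo hx.1, D.ρ2_rot a (D.T_subset_N₃ _ hx.1)]

/-- On `V`, `0 < r2` exactly off the surface. [folklore] -/
theorem r2_pos_iff {y : N} (hy : y ∈ D.Vset) : 0 < D.r2 y ↔ y ∉ range D.b := by
  obtain ⟨x, hx, rfl⟩ := hy
  rw [D.r2_Mo hx, D.ρ2_pos_iff (D.N₃_subset_N₂ (D.T_subset_N₃ _ hx)), D.Mo_mem_range_iff]

/-! ### The moment-map identity transported by `Φ` -/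

omit [T2Space N] [CompactSpace N] in
/-- The orbit map of the model action is differentiable at `t = 0`, with velocity `X_m x`
(by definition of `X_m`). [folklore] -/
theorem hasMFDerivAt_orbit {x : N} (hx : x ∈ D.N₃) :
    HasMFDerivAt 𝓘(ℝ, ℝ) (𝓡 4) (fun t : ℝ ↦ D.rot (Circle.exp t) x) 0
      (mfderiv 𝓘(ℝ, ℝ) (𝓡 4) (fun t : ℝ ↦ D.rot (Circle.exp t) x) 0) :=
  (((D.contMDiff_orbit hx) 0).mdifferentiableAt (by simp)).hasMFDerivAt

/-- **The fundamental field of the conjugated action is `dΦ (X_m)`**: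
`d/dt|₀ (exp t • Φ x) = dΦ_x (X_m x)`. [folklore] -/
theorem mfderiv_actFun_orbit {x : N} (hx : x ∈ D.N₃) :
    mfderiv 𝓘(ℝ, ℝ) (𝓡 4) (fun t : ℝ ↦ D.actFun (Circle.exp t) (D.Mo x)) 0 (1 : ℝ) =
      mfderiv (𝓡 4) (𝓡 4) D.Mo x (D.Xm x) := by
  have hfun : (fun t : ℝ ↦ D.actFun (Circle.exp t) (D.Mo x)) = D.Mo ∘ fun t : ℝ ↦ D.rot (Circle.exp t) x := by
    funext t; exact D.actFun_Mo _ x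
  have hΦ : HasMFDerivAt (𝓡 4) (𝓡 4) D.Mo (D.rot (Circle.exp 0) x)
      (mfderiv (𝓡 4) (𝓡 4) D.Mo (D.rot (Circle.exp 0) x)) :=
    (D.Mo.contMDiffAt.mdifferentiableAt (by simp)).hasMFDerivAt
  have h := (hΦ.comp 0 (D.hasMFDerivAt_orbit hx)).mfderiv
  rw [hfun, h, D.rot_exp_zero hx]
  rfl

/-- **The moment-map identity on `W`** (level of `N`): for `x ∈ T ε₅ ∖ b(S)` and the
fundamental vector `X = d/dt|₀ (exp t • Φ x)` of the conjugated action,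
`s (Φ x) (X, w) = d(-r2/2)_{Φ x} (w)`. [cite: Mclean2012, Lemma 5.14] -/
theorem momentMap_N {x : N} (hx : x ∈ D.T D.ε₅ \ range D.b) (w : E4) :
    D.s (D.Mo x) ![mfderiv 𝓘(ℝ, ℝ) (𝓡 4) (fun t : ℝ ↦ D.actFun (Circle.exp t) (D.Mo x)) 0 (1 : ℝ), w] =
      mfderiv (𝓡 4) 𝓘(ℝ, ℝ) (fun z ↦ -(1 / 2 : ℝ) * D.r2 z) (D.Mo x) w := by
  have hx3 : x ∈ D.N₃ := D.T_subset_N₃ _ hx.1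
  have hxO : x ∈ D.O₄ := D.T₅_subset_O₄ hx.1
  set v : E4 := mfderiv (𝓡 4) (𝓡 4) D.Mo.symm (D.Mo x) w with hv
  have hw : mfderiv (𝓡 4) (𝓡 4) D.Mo x v = w := D.mfderiv_mfderiv_symm' x w
  -- left-hand side: Moser and the model moment map
  have hm : D.s (D.Mo x) ![mfderiv (𝓡 4) (𝓡 4) D.Mo x (D.Xm x), mfderiv (𝓡 4) (𝓡 4) D.Mo x v] =
      D.sM x ![D.Xm x, v] := D.moser_pullback hxO (D.Xm x) v
  rw [D.mfderiv_actFun_orbit hx3, ← hw, hm, D.sM_Xm hx3 v]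
  -- right-hand side: the chain rule through `Φ⁻¹`
  have hx1 : x ∈ D.N₁ := D.N₃_subset_N₁ hx3
  have hρ : HasMFDerivAt (𝓡 4) 𝓘(ℝ, ℝ) D.ρ2 x (D.dρ2 x) := (D.mdifferentiableAt_ρ2 hx1).hasMFDerivAt
  have hg : HasMFDerivAt (𝓡 4) 𝓘(ℝ, ℝ) D.g x (D.dρ2 x) := hρ.congr_of_eventuallyEq (D.g_eventuallyEq hx.1)
  have hg' : HasMFDerivAt (𝓡 4) 𝓘(ℝ, ℝ) D.g (D.Mo.symm (D.Mo x)) (D.dρ2 x) := by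
    rw [D.Mo.symm_apply_apply]; exact hg
  have hsymm : HasMFDerivAt (𝓡 4) (𝓡 4) D.Mo.symm (D.Mo x) (mfderiv (𝓡 4) (𝓡 4) D.Mo.symm (D.Mo x)) :=
    (D.Mo.symm.contMDiffAt.mdifferentiableAt (by simp)).hasMFDerivAt
  have hcomp := (hg'.comp (D.Mo x) hsymm).const_smul (-(1 / 2 : ℝ))
  have hfun : (fun z ↦ -(1 / 2 : ℝ) * D.r2 z) = (-(1 / 2 : ℝ)) • (D.g ∘ D.Mo.symm) := rfl
  rw [hfun, hcomp.mfderiv]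
  change -(1 / 2 : ℝ) * D.dρ2 x v = (-(1 / 2 : ℝ)) •
    D.dρ2 x (mfderiv (𝓡 4) (𝓡 4) D.Mo.symm (D.Mo x) (mfderiv (𝓡 4) (𝓡 4) D.Mo x v))
  rw [D.mfderiv_symm_mfderiv, smul_eq_mul]

/-! ### The action on the open submanifold: smoothness, fundamental field, moment map -/

/-- **The conjugated action is smooth on `Circle × W`.** [cite: Mclean2012, Lemma 5.14] -/
theorem contMDiff_act : letI := D.act
    ContMDiff ((𝓡 1).prod (𝓡 4)) (𝓡 4) ∞ (fun p : Circle × D.Wop ↦ p.1 • p.2) := by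
  letI := D.act
  rw [← ContMDiff.subtypeVal_comp_iff]
  have h1 : ContMDiff ((𝓡 1).prod (𝓡 4)) ((𝓡 1).prod (𝓡 4)) ∞
      (fun p : Circle × D.Wop ↦ ((p.1, (p.2 : N)) : Circle × N)) :=
    contMDiff_fst.prodMk (contMDiff_subtype_val.comp contMDiff_snd)
  intro p
  have hp : D.Mo.symm (p.2 : N) ∈ D.N₃ := D.T_subset_N₃ _ (D.symm_mem_of_mem_Wset p.2.2).1
  show ContMDiffAt ((𝓡 1).prod (𝓡 4)) (𝓡 4) ∞ ((fun q : Circle × N ↦ D.actFun q.1 q.2) ∘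
    (fun p : Circle × D.Wop ↦ ((p.1, (p.2 : N)) : Circle × N))) p
  exact ContMDiffAt.comp (I' := (𝓡 1).prod (𝓡 4)) (g := fun q : Circle × N ↦ D.actFun q.1 q.2)
    (f := fun p : Circle × D.Wop ↦ ((p.1, (p.2 : N)) : Circle × N)) p
    (D.contMDiffAt_actFun (p := (p.1, (p.2 : N))) hp) (h1 p)

/-- The orbit map of the action on `W` is smooth. [folklore] -/
theorem contMDiff_orbitW (y : D.Wop) : letI := D.act
    ContMDiff 𝓘(ℝ, ℝ) (𝓡 4) ∞ (fun t : ℝ ↦ (Circle.exp t • y : D.Wop)) := by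
  letI := D.act
  exact ContMDiff.comp (I' := (𝓡 1).prod (𝓡 4)) (g := fun p : Circle × D.Wop ↦ (p.1 • p.2 : D.Wop))
    (f := fun t : ℝ ↦ ((Circle.exp t, y) : Circle × D.Wop)) D.contMDiff_act
    ((contMDiff_circleExp (m := ∞)).prodMk contMDiff_const)

/-- **The fundamental vector of the action on `W` is the `N`-level orbit velocity.** [folklore] -/
theorem circleFundVec_eq_mfderiv (y : D.Wop) : letI := D.act
    (circleFundVec y : E4) =
      mfderiv 𝓘(ℝ, ℝ) (𝓡 4) (fun t : ℝ ↦ D.actFun (Circle.exp t) (y : N)) 0 (1 : ℝ) := by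
  letI := D.act
  have horb : HasMFDerivAt 𝓘(ℝ, ℝ) (𝓡 4) (fun t : ℝ ↦ (Circle.exp t • y : D.Wop)) 0
      (mfderiv 𝓘(ℝ, ℝ) (𝓡 4) (fun t : ℝ ↦ (Circle.exp t • y : D.Wop)) 0) :=
    (((D.contMDiff_orbitW y) 0).mdifferentiableAt (by simp)).hasMFDerivAt
  have hval := OpenSubmanifold.hasMFDerivAt_subtype_val (I := 𝓡 4) (Circle.exp 0 • y : D.Wop)
  have hcomp := (hval.comp 0 horb).mfderiv
  have hfun : (Subtype.val ∘ fun t : ℝ ↦ (Circle.exp t • y : D.Wop)) =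
      fun t : ℝ ↦ D.actFun (Circle.exp t) (y : N) := rfl
  rw [hfun] at hcomp
  rw [hcomp]
  rfl

/-- **The fundamental field of the action on `W` does not vanish** (free smooth circle action,
tree `mfderiv_circleOrbit_ne_zero`). [cite: LeeSmoothManifolds2013, Prop. 21.7] -/
theorem circleFundVec_ne_zero (y : D.Wop) : letI := D.act; (circleFundVec y : E4) ≠ 0 := by
  letI := D.act
  have h := mfderiv_circleOrbit_ne_zero (k := 4) (N := D.Wop) (θ := fun a y ↦ a • y) D.contMDiff_act
    (fun n ↦ one_smul _ n) (fun a c n ↦ mul_smul a c n)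
    (fun a n h ↦ D.eq_one_of_actFun_eq n.2 (congrArg Subtype.val h)) y
  intro h0
  apply h
  have h0' : mfderiv 𝓘(ℝ, ℝ) (𝓡 4) (fun t : ℝ ↦ (Circle.exp t • y : D.Wop)) 0 (1 : ℝ) = 0 := h0
  ext1
  exact h0'

/-- **The moment-map identity on the open submanifold `W`**:
`s (X, w) = d(-r2/2) (w)` with `X` the fundamental vector of the action on `W`.
[cite: Mclean2012, Lemma 5.14] -/
theorem momentMap_W (y : D.Wop) (w : E4) : letI := D.act
    D.s (y : N) ![circleFundVec y, w] =
      mfderiv (𝓡 4) 𝓘(ℝ, ℝ) (fun z : D.Wop ↦ -(1 / 2 : ℝ) * D.r2 (z : N)) y w := by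
  letI := D.act
  obtain ⟨x, hx, hxy⟩ : (y : N) ∈ D.Wset := y.2
  -- the right-hand side through `Subtype.val`
  have hF : HasMFDerivAt (𝓡 4) 𝓘(ℝ, ℝ) (fun z : N ↦ -(1 / 2 : ℝ) * D.r2 z) (y : N)
      (mfderiv (𝓡 4) 𝓘(ℝ, ℝ) (fun z : N ↦ -(1 / 2 : ℝ) * D.r2 z) (y : N)) :=
    (((contMDiff_const.mul D.contMDiff_r2) (y : N)).mdifferentiableAt (by simp)).hasMFDerivAt
  have hval := OpenSubmanifold.hasMFDerivAt_subtype_val (I := 𝓡 4) y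
  have hcomp := (hF.comp y hval).mfderiv
  have hfun : ((fun z : N ↦ -(1 / 2 : ℝ) * D.r2 z) ∘ Subtype.val) =
      fun z : D.Wop ↦ -(1 / 2 : ℝ) * D.r2 (z : N) := rfl
  rw [hfun] at hcomp
  rw [hcomp]
  -- now everything is on `N`, at the point `y = Φ x`
  have key := D.momentMap_N hx w
  rw [hxy] at key
  have hc := D.circleFundVec_eq_mfderiv y
  have e1 : (![circleFundVec y, w] : Fin 2 → E4) =
      ![mfderiv 𝓘(ℝ, ℝ) (𝓡 4) (fun t : ℝ ↦ D.actFun (Circle.exp t) (y : N)) 0 (1 : ℝ), w] :=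
    congrArg (fun u : E4 ↦ (![u, w] : Fin 2 → E4)) hc
  exact (congrArg (fun u : Fin 2 → E4 ↦ D.s (y : N) u) e1).trans key

/-! ### The tube data -/

/-- **McLean's Lemma 5.14 for `k = 1`, packaged as tube data**: the punctured tube `W`, the
conjugated circle action on it, the transported squared radius `r2`, the tube `V` and the level
`ε₀ = ε₅/2`, with all the properties consumed by
`Literature.Geometry.Symplectic.mclean_convex_of_tubeData`. [cite: Mclean2012, Lemma 5.14] -/
theorem tubeData [ConnectedSpace S] (U : TopologicalSpace.Opens N) (hU : (U : Set N) = (range D.b)ᶜ) :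
    ∃ (W : TopologicalSpace.Opens N) (_ : W ≤ U) (act : MulAction Circle W) (r2 : N → ℝ)
      (V : Set N) (ε₀ : ℝ),
      (letI := act
       ContMDiff ((𝓡 1).prod (𝓡 4)) (𝓡 4) ∞ (fun p : Circle × W => p.1 • p.2) ∧
        (∀ (a : Circle) (x : W), a • x = x → a = 1) ∧
        (∀ x : W, (circleFundVec x : EuclideanSpace ℝ (Fin 4)) ≠ 0) ∧
        ContMDiff (𝓡 4) 𝓘(ℝ, ℝ) ∞ r2 ∧
        (∀ (a : Circle) (x : W), r2 ((a • x : W) : N) = r2 (x : N)) ∧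
        (∀ (x : W) (w : EuclideanSpace ℝ (Fin 4)), D.s (x : N) ![circleFundVec x, w] =
          mfderiv (𝓡 4) 𝓘(ℝ, ℝ) (fun y : W ↦ -(1 / 2) * r2 (y : N)) x w) ∧
        IsOpen V ∧ (U : Set N)ᶜ ⊆ V ∧ (∀ x ∈ V, 0 < r2 x ↔ x ∈ U) ∧ 0 < ε₀ ∧
        (∀ ε, 0 < ε → ε ≤ ε₀ → IsClosed {x | x ∈ V ∧ r2 x ≤ ε}) ∧
        (∀ x ∈ V, x ∈ U → r2 x ≤ ε₀ → x ∈ W) ∧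
        IsPreconnected {x : W | r2 (x : N) < ε₀} ∧
        (∃ x : N, x ∈ V → ε₀ < r2 x)) := by
  have hWU : D.Wop ≤ U := by
    intro y hy
    have h : y ∈ (U : Set N) := by rw [hU]; exact D.Wset_subset_compl hy
    exact h
  have hmemU : ∀ {y : N}, y ∈ U ↔ y ∉ range D.b := fun {y} ↦ by
    rw [← SetLike.mem_coe, hU]; rfl
  refine ⟨D.Wop, hWU, D.act, D.r2, D.Vset, D.ε₅ / 2, ?_⟩
  letI := D.act
  have hε₀ : 0 < D.ε₅ / 2 := half_pos D.ε₅_pos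
  have hε₀lt : D.ε₅ / 2 < D.εc := by linarith [D.ε₅_lt, D.ε₅_pos]
  refine ⟨D.contMDiff_act, fun a x h ↦ D.eq_one_of_actFun_eq x.2 (congrArg Subtype.val h),
    D.circleFundVec_ne_zero, D.contMDiff_r2, fun a x ↦ D.r2_actFun a x.2, D.momentMap_W,
    D.isOpen_Vset, ?_, ?_, hε₀, ?_, ?_, ?_, ?_⟩
  · -- the surface lies in `V`
    intro y hy
    rw [hU, compl_compl] at hy
    obtain ⟨z, rfl⟩ := hy
    exact ⟨D.b z, D.b_mem_T D.ε₅_pos z, D.Mo_b z⟩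
  · -- `0 < r2 ↔ off the surface` on `V`
    intro y hy
    rw [D.r2_pos_iff hy, hmemU]
  · -- closed sub-tubes
    intro ε hε hεle
    have hεlt : ε < D.εc := by linarith
    have heq : {x | x ∈ D.Vset ∧ D.r2 x ≤ ε} = D.Mo '' D.Tbar ε := by
      ext y
      constructor
      · rintro ⟨⟨x, hx, rfl⟩, hr⟩
        rw [D.r2_Mo hx] at hr
        exact ⟨x, ⟨D.T_subset_N₃ _ hx, hr⟩, rfl⟩
      · rintro ⟨x, hx, rfl⟩
        have hxT : x ∈ D.T D.ε₅ := ⟨hx.1, by linarith [hx.2]⟩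
        exact ⟨⟨x, hxT, rfl⟩, by rw [D.r2_Mo hxT]; exact hx.2⟩
    rw [heq]
    have h := D.Mo.toHomeomorph.isClosedMap _ (D.isClosed_Tbar hεlt)
    rwa [Diffeomorph.coe_toHomeomorph] at h
  · -- the shell lies in `W`
    rintro y ⟨x, hx, rfl⟩ hyU -
    rw [hmemU, D.Mo_mem_range_iff] at hyU
    exact ⟨x, ⟨hx, hyU⟩, rfl⟩
  · -- the punctured inner tube is preconnected
    have himg : (Subtype.val : D.Wop → N) '' {x : D.Wop | D.r2 (x : N) < D.ε₅ / 2} =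
        D.Mo '' (D.T (D.ε₅ / 2) \ range D.b) := by
      ext y
      constructor
      · rintro ⟨⟨y, hyW⟩, hr, rfl⟩
        obtain ⟨x, hx, rfl⟩ : y ∈ D.Wset := hyW
        simp only [mem_setOf_eq] at hr
        rw [D.r2_Mo hx.1] at hr
        exact ⟨x, ⟨⟨hx.1.1, hr⟩, hx.2⟩, rfl⟩
      · rintro ⟨x, hx, rfl⟩
        have hxT : x ∈ D.T D.ε₅ := D.T_mono (by linarith [D.ε₅_pos]) hx.1
        refine ⟨⟨D.Mo x, ⟨x, ⟨hxT, hx.2⟩, rfl⟩⟩, ?_, rfl⟩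
        simp only [mem_setOf_eq]
        rw [D.r2_Mo hxT]
        exact hx.1.2
    have key : IsPreconnected ((Subtype.val : D.Wop → N) '' {x : D.Wop | D.r2 (x : N) < D.ε₅ / 2}) := by
      rw [himg]
      exact (D.isPreconnected_T_diff_range hε₀lt).image _ D.Mo.contMDiff.continuous.continuousOn
    exact (Topology.IsInducing.subtypeVal.isPreconnected_image).1 key
  · -- a point of `V` beyond the level `ε₀`
    obtain ⟨y₀⟩ := (inferInstance : Nonempty S)
    obtain ⟨x, hx3, -, hρ⟩ := D.exists_ρ2_eq (t := 3 * D.ε₅ / 4) (by linarith [D.ε₅_pos])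
      (by linarith [D.ε₅_lt, D.ε₅_pos]) y₀
    have hxT : x ∈ D.T D.ε₅ := ⟨hx3, by rw [hρ]; linarith [D.ε₅_pos]⟩
    refine ⟨D.Mo x, fun _ ↦ ?_⟩
    rw [D.r2_Mo hxT, hρ]
    linarith [D.ε₅_pos]

end Setup

/-! ### From the hypotheses of the fact -/

/-- **The tube data of a closed symplectic surface in a compact symplectic `4`-manifold**
(McLean 2012, Lemma 5.14, `k = 1`), from the bare hypotheses of
`mclean_divisorComplement_convex_four`: Whitney-embed `N`, assemble the `Setup`, and apply
`Setup.tubeData`; an empty surface is the degenerate case `W = ∅`. [cite: Mclean2012, Lemma 5.14] -/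
theorem exists_tubeData
    {N : Type*} [TopologicalSpace N] [T2Space N] [CompactSpace N] [ConnectedSpace N]
    [ChartedSpace (EuclideanSpace ℝ (Fin 4)) N] [IsManifold (𝓡 4) ∞ N]
    (s : MForm (𝓡 4) N ℝ 2) (hs : IsSmoothForm s) (hsc : IsClosedForm s)
    (hnd : ∀ x (v : TangentSpace (𝓡 4) x), v ≠ 0 → ∃ w, s x ![v, w] ≠ 0)
    {S : Type*} [TopologicalSpace S] [T2Space S] [CompactSpace S] [ConnectedSpace S]
    [ChartedSpace (EuclideanSpace ℝ (Fin 2)) S] [IsManifold (𝓡 2) ∞ S] (b : S → N)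
    (hb : Manifold.IsSmoothEmbedding (𝓡 2) (𝓡 4) ∞ b)
    (hbs : ∀ y (v : TangentSpace (𝓡 2) y), v ≠ 0 → ∃ w : TangentSpace (𝓡 2) y,
      s (b y) ![mfderiv (𝓡 2) (𝓡 4) b y v, mfderiv (𝓡 2) (𝓡 4) b y w] ≠ 0)
    (U : TopologicalSpace.Opens N) (hU : (U : Set N) = (Set.range b)ᶜ) :
    ∃ (W : TopologicalSpace.Opens N) (_ : W ≤ U) (act : MulAction Circle W) (r2 : N → ℝ)
      (V : Set N) (ε₀ : ℝ),
      (letI := act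
       ContMDiff ((𝓡 1).prod (𝓡 4)) (𝓡 4) ∞ (fun p : Circle × W => p.1 • p.2) ∧
        (∀ (a : Circle) (x : W), a • x = x → a = 1) ∧
        (∀ x : W, (circleFundVec x : EuclideanSpace ℝ (Fin 4)) ≠ 0) ∧
        ContMDiff (𝓡 4) 𝓘(ℝ, ℝ) ∞ r2 ∧
        (∀ (a : Circle) (x : W), r2 ((a • x : W) : N) = r2 (x : N)) ∧
        (∀ (x : W) (w : EuclideanSpace ℝ (Fin 4)), s (x : N) ![circleFundVec x, w] =
          mfderiv (𝓡 4) 𝓘(ℝ, ℝ) (fun y : W ↦ -(1 / 2) * r2 (y : N)) x w) ∧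
        IsOpen V ∧ (U : Set N)ᶜ ⊆ V ∧ (∀ x ∈ V, 0 < r2 x ↔ x ∈ U) ∧ 0 < ε₀ ∧
        (∀ ε, 0 < ε → ε ≤ ε₀ → IsClosed {x | x ∈ V ∧ r2 x ≤ ε}) ∧
        (∀ x ∈ V, x ∈ U → r2 x ≤ ε₀ → x ∈ W) ∧
        IsPreconnected {x : W | r2 (x : N) < ε₀} ∧
        (∃ x : N, x ∈ V → ε₀ < r2 x)) := by
  rcases isEmpty_or_nonempty S with hS | hS
  · -- empty surface: `W = ⊥`, `V = ∅`, `r2 = 1`, `ε₀ = 1`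
    refine ⟨⊥, bot_le, { smul := fun _ x ↦ x, one_smul := fun _ ↦ rfl, mul_smul := fun _ _ _ ↦ rfl },
      fun _ ↦ 1, ∅, 1, ?_⟩
    have hW : ∀ x : (⊥ : TopologicalSpace.Opens N), False := fun x ↦ x.2
    refine ⟨fun p ↦ (hW p.2).elim, fun _ x ↦ (hW x).elim, fun x ↦ (hW x).elim, contMDiff_const,
      fun _ x ↦ (hW x).elim, fun x ↦ (hW x).elim, isOpen_empty, ?_, fun x hx ↦ hx.elim, one_pos,
      fun ε _ _ ↦ ?_, fun x hx ↦ hx.elim, ?_, ?_⟩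
    · rw [hU, compl_compl]
      rintro _ ⟨y, -⟩
      exact (IsEmpty.false y).elim
    · convert isClosed_empty
      ext x
      simp
    · have : {x : (⊥ : TopologicalSpace.Opens N) | (1 : ℝ) < 1} = ∅ := by
        ext x; exact (hW x).elim
      rw [this]
      exact isPreconnected_empty
    · obtain ⟨x⟩ := (inferInstance : Nonempty N)
      exact ⟨x, fun hx ↦ hx.elim⟩
  · -- the main case
    obtain ⟨n, e, he, hemb, hde⟩ := exists_embedding_euclidean_of_compact (I := 𝓡 4) (M := N)
    let D : Setup N S (EuclideanSpace ℝ (Fin n)) :=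
      { s := s, e := e, b := b, hs := hs, hsc := hsc, hnd := hnd, he := he, heinj := hemb.injective,
        hde := hde, hb := hb.contMDiff, hbinj := hb.isEmbedding.injective,
        hdb := fun y ↦ Literature.Topology.FourManifolds.Manifold.IsImmersionAt.mfderiv_injective
          (hb.isImmersion.isImmersionAt y) (by simp),
        hbs := hbs }
    exact D.tubeData U hU

end SurfaceTube

end Literature.Geometry.Symplectic
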